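import Summits.AnomalousDissipation.AnomalousDissipation.Theorems.BaireTransferDenseLoudDesignerForcesErgodicLine
import Literature.Analysis.FluidPDE.TorusTwoBackgroundGevreySmoothing

/-!
# Two-background Gevrey smoothing of the linearised flow on `T³` (tools stub T1g₂
# `stub_twoBackgroundGevreySmoothingTools`, block N-R, line `ergodic-budget-selection-closing`,
# crux `BaireTransfer.DenseLoudDesignerForces`, stmt-AnomalousDissipation-1143)

Summit-side specialisation to `T³ = UnitAddTorus (Fin 3)` of the Literature theorem
`Torus.twoBackground_gevrey_of_gevreyBound` (`Literature/Analysis/FluidPDE/TorusTwoBackgroundGevreySmoothing.lean`,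
over the two-background Gevrey balance `…/TorusTwoBackgroundGevreyBalance.lean` and the two-background `H¹` growth
`…/TorusTwoBackgroundH1Balance.lean`; the TWO-BACKGROUND twin of the linear Foias–Temam Gevrey-class estimate
`Torus.linearisedNS_gevrey_of_gevreyBound`, J. Funct. Anal. 87 (1989), Thm 1.1 / Lemma 2.1, run with truncated
Gevrey weights on the lattice `ℤ³`): along two jointly smooth divergence-free backgrounds `u₁, u₂` on
`[a, a + τ] × T³` which are uniformly Gevrey, `∑_{k ∈ S'} e^{2σ₀|k|} ‖ûⱼ(t, k)‖² ≤ C₀`, every jointly smooth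
divergence-free mean-zero solution `(w, q)` of `∂ₜw + (u₁·∇)w + (w·∇)u₂ = νΔw − ∇q` (advection by `u₁`, stretching of
`u₂`: the equation of the difference of two linearised solutions along two trajectories, and of second variations)
satisfies `∑_{k ∈ S'} e^{2σ|k|} ‖ŵ(a + τ, k)‖² ≤ C (‖w(a)‖₂² + ‖∇w(a)‖₂²)` with `σ > 0`, `C` depending only on
`(ν, σ₀, C₀, τ)` (block N-R of the smooth-model construction: existence of the mixed partial `∂_y ∂ₜ g` and Lipschitz
dependence of the trajectory in Gevrey norm).  The registered tools stub `stub_twoBackgroundGevreySmoothingTools` is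
proved BY NAME with exactly the registered signature (the hypothesis `div u₂ = 0` is part of the registered signature
but is not needed by the proof).

Reference: C. Foias, R. Temam, *Gevrey class regularity for the solutions of the Navier–Stokes equations*,
J. Funct. Anal. 87 (1989) 359–369, Thm 1.1, Lemma 2.1.
-/

-- `Summit.<Summit>.<Problem>` is the tree's mandated summit-side namespace (CONVENTIONS §2); for this
-- single-conjunct summit the two coincide, so the duplicate is deliberate.
set_option linter.dupNamespace false

noncomputable section

open scoped BigOperators Topology ENNReal InnerProductSpace
open Filter Set Function MeasureTheory

namespace Summit.AnomalousDissipation.AnomalousDissipation.Theorems.DenseLoudDesignerForces.Ergodic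

open Literature.Analysis.FunctionSpaces Literature.Analysis.FunctionSpaces.Torus
open Literature.Analysis.FluidPDE Literature.Analysis.FluidPDE.Torus

/-- **Tools stub T1g₂ of block N-R (`stub_twoBackgroundGevreySmoothingTools`, crux stmt-AnomalousDissipation-1143,
line `ergodic-budget-selection-closing`) — two-background Gevrey smoothing of the linearised flow.**  For `ν > 0`, a
Gevrey radius `σ₀ > 0` and level `C₀` of the backgrounds and a time lapse `τ > 0` there are `σ > 0` and `C` such that:
along every pair of jointly smooth divergence-free backgrounds `u₁, u₂` on `[a, a + τ] × T³` with
`∑_{k ∈ S'} e^{2σ₀|k|} ‖ûⱼ(t, k)‖² ≤ C₀` for all `t`, all finite `S'` and `j = 1, 2`, every jointly smooth `(w, q)` with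
`div w(t) = 0`, `∫ w(t) = 0` and `∂ₜw + (u₁·∇)w + (w·∇)u₂ = νΔw − ∇q` pointwise (one-sided time derivative within
`[a, a + τ]`) satisfies `∑_{k ∈ S'} e^{2σ|k|} ‖ŵ(a + τ, k)‖² ≤ C (∫ ‖w(a)‖² + ‖∇w(a)‖₂²)` for every finite `S'` — the
linear Gevrey balance `Y_R' ≤ −(5/4)κ Z_R + K Y` with the combined background family `‖û₁‖ + ‖û₂‖`, its two-level time
integration, a bootstrap at the levels `2y₀ + ε` and the exponential `H¹` bound of the two-background flow
(`Torus.twoBackground_gevrey_of_gevreyBound` at `d = Fin 3`; `div u₂ = 0` is not used). [cite: FoiasTemam1989, Thm 1.1 and Lemma 2.1] -/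
theorem stub_twoBackgroundGevreySmoothingTools {ν : ℝ} (hν : 0 < ν) (σ₀ C₀ τ : ℝ) (hσ₀ : 0 < σ₀) (hτ : 0 < τ) :
    ∃ σ : ℝ, 0 < σ ∧ ∃ C : ℝ, ∀ {a : ℝ} {u₁ u₂ w : ℝ → (UnitAddTorus (Fin 3)) → (EuclideanSpace ℝ (Fin 3))}
      {q : ℝ → (UnitAddTorus (Fin 3)) → ℝ},
      IsSmoothSpaceTimeOn (Icc a (a + τ)) u₁ → (∀ t ∈ Icc a (a + τ), IsDivFree (u₁ t)) →
      IsSmoothSpaceTimeOn (Icc a (a + τ)) u₂ → (∀ t ∈ Icc a (a + τ), IsDivFree (u₂ t)) →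
      (∀ t ∈ Icc a (a + τ), ∀ S' : Finset (Fin 3 → ℤ), ∑ k ∈ S', Real.exp (2 * σ₀ * Real.sqrt (freqNormSq k)) *
        ‖UnitAddTorus.mFourierCoeff (EuclideanSpace.complexify ∘ u₁ t) k‖ ^ 2 ≤ C₀) →
      (∀ t ∈ Icc a (a + τ), ∀ S' : Finset (Fin 3 → ℤ), ∑ k ∈ S', Real.exp (2 * σ₀ * Real.sqrt (freqNormSq k)) *
        ‖UnitAddTorus.mFourierCoeff (EuclideanSpace.complexify ∘ u₂ t) k‖ ^ 2 ≤ C₀) →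
      IsSmoothSpaceTimeOn (Icc a (a + τ)) w → IsSmoothSpaceTimeOn (Icc a (a + τ)) q →
      (∀ t ∈ Icc a (a + τ), IsDivFree (w t)) → (∀ t ∈ Icc a (a + τ), HasZeroMean (w t)) →
      (∀ t ∈ Icc a (a + τ), ∀ x, Torus.timeDerivWithin (Icc a (a + τ)) w t x + convect (u₁ t) (w t) x + convect (w t) (u₂ t) x =
        ν • laplacian (w t) x - Torus.gradient (q t) x) →
      ∀ S' : Finset (Fin 3 → ℤ), ∑ k ∈ S', Real.exp (2 * σ * Real.sqrt (freqNormSq k)) *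
        ‖UnitAddTorus.mFourierCoeff (EuclideanSpace.complexify ∘ w (a + τ)) k‖ ^ 2 ≤
          C * ((∫ x, ‖w a x‖ ^ 2) + gradNormSq (w a)) := by
  obtain ⟨σ, hσ, C, hC⟩ := twoBackground_gevrey_of_gevreyBound (d := Fin 3) hν σ₀ C₀ τ hσ₀ hτ
  exact ⟨σ, hσ, C, fun hu₁ hu₁div hu₂ _ hgev₁ hgev₂ hw hq hwdiv hzm hlin =>
    hC hu₁ hu₁div hu₂ hgev₁ hgev₂ hw hq hwdiv hzm hlin⟩

end Summit.AnomalousDissipation.AnomalousDissipation.Theorems.DenseLoudDesignerForces.Ergodic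

end
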